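import Literature.AlgebraicGeometry.Frobenioids.RlfPerfFactorial
import Literature.AnabelianGeometry.EtaleTheta.RealificationUniversal
import Literature.AnabelianGeometry.EtaleTheta.FrdIVocabulary
import Literature.AnabelianGeometry.EtaleTheta.TemperedFrobenioid

/-!
# The realification `Φ ↦ Φ^rlf` as a functor ([FrdI] Prop. 5.3; [EtTh] Def. 3.6 (i) `Φ₀^ℝ := Φ₀^rlf`)

Sources: S. Mochizuki, *The geometry of Frobenioids I* [MochizukiFrdI2008], Def. 2.4 (i) p. 48 (the
realification `M^rlf` of a perf-factorial monoid) and Prop. 5.3 p. 103 ("the divisor monoid `Φ^rlf`" of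
a perf-factorial monoid `Φ` on a category); S. Mochizuki, *The étale theta function …*
[MochizukiEtTh2009], Def. 3.6 (i), PDF p. 76 (printed 302): "`Φ₀^ℝ := Φ₀^rlf` … where `Φ₀^rlf` is as in
[FrdI], Definition 2.4, (i) [cf. Proposition 3.4, (i)]".

Print applies `M ↦ M^rlf` to a monoid-valued FUNCTOR without comment. This file CONSTRUCTS that
functor for any `Φ : J ⥤ CommMonCat` with perf-factorial values, from the universal property of the
realification (`RealificationUniversal.lean`: `RlfUniversal.existsUnique_map`, `map_id`, `map_comp`)
and "`ℝ` supports `M^rlf`" (`IsPerfFactorial.supports_rlf_R`, seat abc-iut-L1-d2):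

* `rlfMap Φ hΦ f : Φ(j)^rlf → Φ(j')^rlf`, the unique homomorphism over `Φ(f)^pf`; `rlfMap_id`,
  `rlfMap_comp`;
* `rlfFunctor Φ hΦ : J ⥤ CommMonCat` (`j ↦ Φ(j)^rlf`) and the natural transformation
  `toRlfNatTrans : Φ ⟶ Φ^rlf` (`Φ(j) → Φ(j)^pf → Φ(j)^rlf`);
* `isRealificationVia_toRealification`: each component exhibits `Φ(j)^rlf` as the realification of
  `Φ(j)` in the sense of `IsRealificationVia` (`FrdIVocabulary.lean`) — i.e. the fields `ΦR`, `toR`,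
  `toR_natural`, `isRealification` of the §3 statement file's `RealifiedDivisorMonoids` (Def. 3.6 (i),
  seat abc-iut-L2-t3) are CONSTRUCTIBLE from `Φ₀` + Prop. 3.4 (i) ("`Φ₀(Y^log)` is perf-factorial");
  the `Λ`-dependent fields (`B₀^Λ`, `F₀^Λ`, `ℝ·Φ₀^cnst`, …) are not built here (additive constructor
  `RealifiedDivisorMonoids.ofRlf`, L1-lead ruling (H) 20:53Z, to follow with the `ℝ`-span vocabulary);
* `RealifiedDivisorMonoids.nonempty_iso_rlfFunctor`: conversely, for ANY Def. 3.6 (i) data `T` over the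
  tree's vocabulary, `T.ΦR` IS the realification functor of `T.Φ₀` — canonically isomorphic to
  `rlfFunctor T.Φ₀`, compatibly with `toR` (rigidity: the fields `isRealification` + `toR_natural`
  determine `ΦR` up to unique isomorphism, by the universal property).

Seat abc-iut-L2-d2 (cell abc-iut; merge-debt reducer for [EtTh] Def. 3.6 / [FrdI] Prop. 5.3).
-/

noncomputable section

namespace Literature.AnabelianGeometry.EtaleTheta

open CategoryTheory Literature.AlgebraicGeometry.Frobenioids

universe w v u

section RlfFunctor

variable {J : Type u} [Category.{v} J] (Φ : J ⥤ CommMonCat.{w})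
  (hΦ : ∀ j : J, IsPerfFactorial (Φ.obj j))

/-- **`Φ(f)^rlf`**: for `f : j → j'`, the unique homomorphism `Φ(j)^rlf → Φ(j')^rlf` over
`Φ(f)^pf : Φ(j)^pf → Φ(j')^pf` (universal property of the realification; `ℝ` supports `Φ(j')^rlf`).
[cite: MochizukiFrdI2008, Prop. 5.3 p.103] -/
def rlfMap {j j' : J} (f : j ⟶ j') : (hΦ j).Rlf →* (hΦ j').Rlf :=
  Classical.choose (RlfUniversal.existsUnique_map (hΦ j) (hΦ j') (hΦ j').supports_rlf_R (Φ.map f).hom).exists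

/-- The defining property of `rlfMap`: it lies over `Φ(f)^pf`. [cite: MochizukiFrdI2008, Prop. 5.3 p.103] -/
theorem rlfMap_comp_toRealification {j j' : J} (f : j ⟶ j') :
    (rlfMap Φ hΦ f).comp (hΦ j).toRealification =
      (hΦ j').toRealification.comp (Perfection.map (Φ.map f).hom) :=
  Classical.choose_spec
    (RlfUniversal.existsUnique_map (hΦ j) (hΦ j') (hΦ j').supports_rlf_R (Φ.map f).hom).exists

/-- `rlfMap` on the image of `Φ(j)`: `Φ(f)^rlf (a) = Φ(f)(a)` for `a ∈ Φ(j)` (through `Φ → Φ^pf → Φ^rlf`).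
[cite: MochizukiFrdI2008, Prop. 5.3 p.103] -/
theorem rlfMap_toRealification_of {j j' : J} (f : j ⟶ j') (a : Φ.obj j) :
    rlfMap Φ hΦ f ((hΦ j).toRealification (Perfection.of _ a)) =
      (hΦ j').toRealification (Perfection.of _ ((Φ.map f).hom a)) := by
  have h := DFunLike.congr_fun (rlfMap_comp_toRealification Φ hΦ f) (Perfection.of _ a)
  rw [MonoidHom.comp_apply, MonoidHom.comp_apply] at h
  rw [h]
  rfl

/-- `Φ(𝟙)^rlf = 𝟙`. [cite: MochizukiFrdI2008, Prop. 5.3 p.103] -/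
theorem rlfMap_id (j : J) : rlfMap Φ hΦ (𝟙 j) = MonoidHom.id _ := by
  apply RlfUniversal.map_id (hΦ j) (hΦ j).supports_rlf_R
  rw [rlfMap_comp_toRealification, CategoryTheory.Functor.map_id]
  rfl

/-- `Φ(f ≫ g)^rlf = Φ(g)^rlf ∘ Φ(f)^rlf`. [cite: MochizukiFrdI2008, Prop. 5.3 p.103] -/
theorem rlfMap_comp {j j' j'' : J} (f : j ⟶ j') (g : j' ⟶ j'') :
    rlfMap Φ hΦ (f ≫ g) = (rlfMap Φ hΦ g).comp (rlfMap Φ hΦ f) := by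
  apply RlfUniversal.map_comp (hΦ j) (hΦ j') (hΦ j'') (hΦ j'').supports_rlf_R (Φ.map f).hom (Φ.map g).hom
    (rlfMap Φ hΦ f) (rlfMap_comp_toRealification Φ hΦ f) (rlfMap Φ hΦ g)
    (rlfMap_comp_toRealification Φ hΦ g)
  rw [rlfMap_comp_toRealification, Functor.map_comp]
  rfl

/-- **The realification functor `Φ^rlf : J ⥤ CommMonCat`**, `j ↦ Φ(j)^rlf` ("the divisor monoid `Φ^rlf`",
[FrdI] Prop. 5.3; "`Φ₀^ℝ := Φ₀^rlf`", [EtTh] Def. 3.6 (i)). [cite: MochizukiFrdI2008, Prop. 5.3 p.103] -/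
def rlfFunctor : J ⥤ CommMonCat.{w} where
  obj j := CommMonCat.of (hΦ j).Rlf
  map f := CommMonCat.ofHom (rlfMap Φ hΦ f)
  map_id j := by
    rw [rlfMap_id]
    rfl
  map_comp f g := by
    rw [rlfMap_comp]
    rfl

/-- `(Φ^rlf).map f` is `rlfMap`. [cite: MochizukiFrdI2008, Prop. 5.3 p.103] -/
@[simp] theorem rlfFunctor_map_hom {j j' : J} (f : j ⟶ j') :
    ((rlfFunctor Φ hΦ).map f).hom = rlfMap Φ hΦ f := rfl

/-- **The natural transformation `Φ ⟶ Φ^rlf`**, `Φ(j) → Φ(j)^pf → Φ(j)^rlf` ([EtTh] Def. 3.6 (i): "the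
natural map `Φ₀ → Φ₀^pf → Φ₀^rlf = Φ₀^ℝ`"). [cite: MochizukiEtTh2009, Def 3.6 p.76] -/
def toRlfNatTrans : Φ ⟶ rlfFunctor Φ hΦ where
  app j := CommMonCat.ofHom ((hΦ j).toRealification.comp (Perfection.of _))
  naturality := by
    intro j j' f
    ext a
    exact (rlfMap_toRealification_of Φ hΦ f a).symm

/-- Each `Φ(j) → Φ(j)^rlf` exhibits `Φ(j)^rlf` as the realification of `Φ(j)` in the sense of the §3
vocabulary (`IsRealificationVia`). [cite: MochizukiEtTh2009, Def 3.6 p.76] -/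
theorem isRealificationVia_toRealification {M : Type w} [CommMonoid M] (hM : IsPerfFactorial M) :
    IsRealificationVia M hM.Rlf (hM.toRealification.comp (Perfection.of M)) :=
  ⟨hM, MulEquiv.refl _, fun _ => rfl⟩

end RlfFunctor

/-! ### Homomorphisms out of `M^pf` into a perfect monoid are determined on `M` -/

/-- Two homomorphisms `M^pf → Q` into a PERFECT monoid that agree on `M` are equal (`n`-th roots are
unique in `Q`). [cite: MochizukiFrdI2008, §0 p.11] -/
theorem Perfection.hom_ext_of_isPerfect {M : Type w} [CommMonoid M] {Q : Type v} [CommMonoid Q]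
    (hQ : IsPerfect Q) {g g' : Perfection M →* Q}
    (h : g.comp (Perfection.of M) = g'.comp (Perfection.of M)) : g = g' := by
  ext x
  obtain ⟨⟨a, n⟩, rfl⟩ := Perfection.mk_surjective x
  apply (hQ.bijective_pow n n.pos).1
  dsimp only
  rw [← map_pow, ← map_pow, Perfection.mk_pow_self]
  exact DFunLike.congr_fun h a

/-! ### Rigidity of the Def. 3.6 (i) realification data -/

namespace RealifiedDivisorMonoids

variable {D₀ : Type u} [Category.{v} D₀] (T : RealifiedDivisorMonoids (D₀ := D₀) treeMonoidVocab.{w})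

/-- For Def. 3.6 (i) data over the tree's vocabulary, every `Φ₀(Y)` is perf-factorial (part of the field
`isRealification : IsRealificationVia …`). [cite: MochizukiEtTh2009, Def 3.6 p.76] -/
theorem isPerfFactorial_Φ₀ (Y : D₀ᵒᵖ) : IsPerfFactorial (T.Φ₀.obj Y) :=
  (T.isRealification Y).1

/-- **Rigidity of `Φ₀^ℝ`.** For any Def. 3.6 (i) data `T` over the tree's vocabulary there is an
isomorphism of functors `T.ΦR ≅ (T.Φ₀)^rlf` (the realification functor) carrying `T.toR` to the natural
maps `Φ₀ → Φ₀^pf → Φ₀^rlf`: the data `ΦR, toR, toR_natural, isRealification` are determined up to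
unique isomorphism (universal property of the realification). [cite: MochizukiEtTh2009, Def 3.6 p.76] -/
theorem nonempty_iso_rlfFunctor :
    ∃ e : T.ΦR ≅ rlfFunctor T.Φ₀ T.isPerfFactorial_Φ₀,
      ∀ (Y : D₀ᵒᵖ) (m : T.Φ₀.obj Y),
        (e.hom.app Y).hom (T.toR Y m) =
          (T.isPerfFactorial_Φ₀ Y).toRealification (Perfection.of _ m) := by
  -- the isomorphisms `e_Y : Φ₀^ℝ(Y) ≅ Φ₀(Y)^rlf` of `IsRealificationVia`
  have hE : ∀ Y : D₀ᵒᵖ, ∃ eY : T.ΦR.obj Y ≃* (T.isPerfFactorial_Φ₀ Y).Rlf,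
      ∀ m, eY (T.toR Y m) = (T.isPerfFactorial_Φ₀ Y).toRealification (Perfection.of _ m) := by
    intro Y
    obtain ⟨h, eY, heY⟩ := T.isRealification Y
    exact ⟨eY, heY⟩
  choose eY heY using hE
  -- naturality: `e_{Y'} ∘ Φ₀^ℝ(f) ∘ e_Y⁻¹` is a map of realifications over `Φ₀(f)^pf`, hence `= rlfMap f`
  have hnat : ∀ {Y Y' : D₀ᵒᵖ} (f : Y ⟶ Y'),
      ((eY Y').toMonoidHom.comp (T.ΦR.map f).hom).comp (eY Y).symm.toMonoidHom =
        rlfMap T.Φ₀ T.isPerfFactorial_Φ₀ f := by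
    intro Y Y' f
    apply (RlfUniversal.existsUnique_map (T.isPerfFactorial_Φ₀ Y) (T.isPerfFactorial_Φ₀ Y')
      (T.isPerfFactorial_Φ₀ Y').supports_rlf_R (T.Φ₀.map f).hom).unique _
      (rlfMap_comp_toRealification T.Φ₀ T.isPerfFactorial_Φ₀ f)
    -- both sides agree on `Φ₀(Y)`, hence on `Φ₀(Y)^pf` (the target `Φ₀(Y')^rlf` is perfect)
    apply Perfection.hom_ext_of_isPerfect (T.isPerfFactorial_Φ₀ Y').supports_rlf_R.1
    refine MonoidHom.ext fun m => ?_
    have h1 : (eY Y).symm ((T.isPerfFactorial_Φ₀ Y).toRealification (Perfection.of _ m)) = T.toR Y m := by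
      rw [MulEquiv.symm_apply_eq, heY]
    show eY Y' ((T.ΦR.map f).hom ((eY Y).symm ((T.isPerfFactorial_Φ₀ Y).toRealification
        (Perfection.of _ m)))) =
      (T.isPerfFactorial_Φ₀ Y').toRealification (Perfection.map (T.Φ₀.map f).hom (Perfection.of _ m))
    rw [h1, ← T.toR_natural, heY]
    rfl
  refine ⟨NatIso.ofComponents (fun Y => (eY Y).toCommMonCatIso) (fun {Y Y'} f => ?_), fun Y m => heY Y m⟩
  ext x
  have h := DFunLike.congr_fun (hnat f) (eY Y x)
  simp only [MonoidHom.comp_apply, MulEquiv.coe_toMonoidHom, MulEquiv.symm_apply_apply] at h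
  exact h

end RealifiedDivisorMonoids

end Literature.AnabelianGeometry.EtaleTheta
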